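import Summits.Parity.GeneralizedHardyLittlewood.Theses.LiouvilleShiftedTables

/-!
# Sketch (crux-ideate, ideator 1) — crux `EH` = stmt-Parity-11314
  (`Summit.Parity.GeneralizedHardyLittlewood.Theses.LiouvilleShiftedTables.EH`,
   `Iff.rfl` with `Literature.NumberTheory.Sieve.LevelOfDistribution.ElliottHalberstam`).

Statements (sorried where marked) plus two PROVED bookkeeping lemmas (`eh_of_weak_of_coherence`,
`weakEHUniform_of_eh`, sorry-free); `lean check` rc 0, 3 sorries.

* §1 calibration: `ExceptionalModuliSparse` and `eh_iff_exceptionalModuliSparse`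
  (EH ⇔ "for every A, all but ≪ Q/(log x)^A moduli q ≤ Q = x^{θ-ε} have NO reduced class off by
  x/(φ(q)(log x)^A)"; Brun–Titchmarsh `card_roughAP_le` + dyadic Markov).
* §2 card `flat-coherence-split`: `WeakEHUniform` (fixed-residue = weak-sense EH, uniform in
  1 ≤ |b| ≤ x, Fouvry–Radziwiłł (eq:goal) shape), `ResidueCoherence` (the derandomisation input:
  the strong sum is controlled by the worst COHERENT = fixed-integer-residue sum up to (log x)^{A'}),
  `eh_of_weak_of_coherence` (pure bookkeeping, PROVED here) and `weakEHUniform_of_eh` (PROVED).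
* §3 route-level finding (for TENURE, not a crux line): `MidParity` — the exact statement the
  route's `closes` consumes from EH once Bombieri–Vinogradov (tree: `bombieri_vinogradov_holds`)
  is subtracted: Möbius ⟂ primes along dilated shifted progressions for MID dilations
  m ∈ (N^ε, N^{1/2+ε}]; `midParity_of_EH` (EH ∧ BV ⇒ MidParity) and `pairsHL_of_midParity`
  (MidParity → MAvg → PairsHL) show EH can be replaced by the strictly weaker MidParity in `closes`.
-/

namespace Summit.Parity.GeneralizedHardyLittlewood.Cruxes.EH.SketchIdeator1

open scoped BigOperators Classical
open Filter Finset Real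
open Summit.Parity.GeneralizedHardyLittlewood.Theses.LiouvilleShiftedTables
  (EH MAvg PairsHL BVLiouville)
open Literature.NumberTheory.Sieve (primeAPError PrimesHaveLevel)
open Literature.NumberTheory.Sieve.LevelOfDistribution (chebyshevPsiMod ElliottHalberstam)

/-! ### §0  The crux by name is the Literature conjecture (grounder's `Iff.rfl`) -/

theorem eh_iff_literature : EH ↔ ElliottHalberstam := Iff.rfl

/-! ### §1  Calibration: exceptional-moduli form -/

/-- Number of "exceptional" moduli `q ∈ (R, 2R]`: some reduced class (at some height `y ≤ x`) is
off by more than `x / (φ(q) (log x)^A)`. -/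
noncomputable def exceptionalCount (x R A : ℝ) : ℕ :=
  #((Ioc ⌊R⌋₊ ⌊2 * R⌋₊).filter fun q : ℕ =>
      x / ((Nat.totient q : ℝ) * Real.log x ^ A) < primeAPError x q)

/-- `ExceptionalModuliSparse` (dyadically uniform form, which is what makes `←` below provable):
for every `θ < 1`, `A > 0`, `ε > 0` there is `C` such that for all large `x` and EVERY dyadic
range `(R, 2R]` with `1 ≤ R ≤ x^{θ-ε}`, the exceptional moduli at precision `(log x)^{-A}` number at
most `C R / (log x)^A`. -/
def ExceptionalModuliSparse : Prop :=
  ∀ θ : ℝ, θ < 1 → ∀ A : ℝ, 0 < A → ∀ ε : ℝ, 0 < ε → ∃ C : ℝ, ∀ᶠ x : ℝ in atTop,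
    ∀ R : ℝ, 1 ≤ R → R ≤ x ^ (θ - ε) →
      (exceptionalCount x R A : ℝ) ≤ C * R / Real.log x ^ A

/-- Calibration lemma (provable, M): EH ⇔ sparse exceptional moduli. `→`: Markov on the EH sum at
exponent `2A + 1`, uniformly in the dyadic range (`φ(q) E*(x;q) (log x)^A / x > 1` on exceptional `q`,
`φ(q) ≤ 2R`). `←`: moduli `q ≤ x^{1/2}/(log x)^B` by Bombieri–Vinogradov (tree:
`Literature.NumberTheory.Sieve.bombieri_vinogradov_holds`); above that, dyadically in `R`:
non-exceptional moduli contribute `≤ ∑ x/(φ(q)(log x)^A) ≪ x (log x)^{1-A}`, exceptional ones at most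
`#exc(R) · max_{q ∼ R} E*(x;q) ≪_θ (C R/(log x)^A) · (x/R)` by Brun–Titchmarsh in the form
`E*(x;q) ≪_θ x/φ(q)` for `q ≤ x^θ` (from `Literature.NumberTheory.Sieve.card_roughAP_le` with
`z = (x/q)^{1/20}`), and there are `≤ log x` ranges — so apply the hypothesis at exponent `A + 1`. -/
theorem eh_iff_exceptionalModuliSparse : EH ↔ ExceptionalModuliSparse := by
  sorry

/-! ### §2  Card `flat-coherence-split`: strong EH ⇐ weak (fixed-residue) EH ∧ residue coherence -/

/-- The fixed-residue ("weak sense") error for the integer residue `b` at modulus `q`: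
`max_{1 ≤ y ≤ x} |ψ(y; q, b) − y/φ(q)|` if `(b, q) = 1`, and `0` otherwise. -/
noncomputable def fixedResidueError (x : ℝ) (q : ℕ) (b : ℤ) : ℝ :=
  if IsUnit ((b : ℤ) : ZMod q) then
    ⨆ y : Set.Icc (1 : ℝ) x, |chebyshevPsiMod q ((b : ℤ) : ZMod q) y - (y : ℝ) / Nat.totient q|
  else 0

/-- `WeakEHUniform` — weak-sense Elliott–Halberstam, uniform in the (integer) residue: for every
`θ < 1`, `A > 0`, `ε > 0` there is `C` with, for all large `x` and EVERY integer `b` with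
`1 ≤ |b| ≤ x`: `∑_{q ≤ x^{θ-ε}} max_{y ≤ x} |ψ(y; q, b) − y/φ(q)|·1_{(b,q)=1} ≤ C x/(log x)^A`.
(Fouvry–Radziwiłł arXiv:1811.08672 (eq:goal): the residue is the SAME integer for all moduli; OPEN
beyond level 1/2 + o(1) with absolute values, known to 4/7 resp. 3/5 only with (triply)
well-factorable weights — BFI 1986 Thm 10, Maynard arXiv:2006.07088.) -/
def WeakEHUniform : Prop :=
  ∀ θ : ℝ, θ < 1 → ∀ A : ℝ, 0 < A → ∀ ε : ℝ, 0 < ε → ∃ C : ℝ, ∀ᶠ x : ℝ in atTop,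
    ∀ b : ℤ, 1 ≤ |b| → (|b| : ℝ) ≤ x →
      ∑ q ∈ Icc 1 ⌊x ^ (θ - ε)⌋₊, fixedResidueError x q b ≤ C * x / Real.log x ^ A

/-- `ResidueCoherence` — the derandomisation input (t = 1 form of `extremal-class-coherence`,
crux stmt-Parity-14833): the STRONG sum (max over residues inside) is controlled, up to a power of
`log x`, by the worst COHERENT sum (one integer residue `b`, `1 ≤ |b| ≤ x`, for all moduli at once):
for every `θ < 1`, `A > 0` there are `A', C` such that for every `ε > 0` and all large `x`,
`∑_{q ≤ x^{θ-ε}} E*(x; q) ≤ C · ( x/(log x)^A + (log x)^{A'} · sup_{1 ≤ |b| ≤ x} ∑_{q ≤ x^{θ-ε}} E_b(x; q) )`.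
Neither implies nor is implied by EH; with `WeakEHUniform` it gives EH (next theorem). -/
def ResidueCoherence : Prop :=
  ∀ θ : ℝ, θ < 1 → ∀ A : ℝ, 0 < A → ∃ A' C : ℝ, ∀ ε : ℝ, 0 < ε → ∀ᶠ x : ℝ in atTop,
    ∑ q ∈ Icc 1 ⌊x ^ (θ - ε)⌋₊, primeAPError x q ≤
      C * (x / Real.log x ^ A +
        Real.log x ^ A' *
          ⨆ b : {b : ℤ // 1 ≤ |b| ∧ (|b| : ℝ) ≤ x},
            ∑ q ∈ Icc 1 ⌊x ^ (θ - ε)⌋₊, fixedResidueError x q (b : ℤ))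

/-- First lemma of the card (PROVED, sorry-free): weak ∧ coherence ⇒ the crux BY NAME.
Proof: fix θ, A, ε; take `A', C` from coherence; apply `WeakEHUniform` at exponent `A + max A' 0`
(its bound is uniform in `b`, so it bounds the `⨆` over the nonempty subtype of residues);
conclude `IsBigO` with constant `|C| (1 + |C₂|)`. -/
theorem fixedResidueError_nonneg (x : ℝ) (q : ℕ) (b : ℤ) : 0 ≤ fixedResidueError x q b := by
  unfold fixedResidueError
  split_ifs
  · exact Real.iSup_nonneg fun _ => abs_nonneg _
  · exact le_rfl

theorem eh_of_weak_of_coherence (hW : WeakEHUniform) (hC : ResidueCoherence) : EH := by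
  intro θ hθ A hA ε hε
  change (fun x : ℝ => ∑ q ∈ Icc 1 ⌊x ^ (θ - ε)⌋₊, primeAPError x q) =O[atTop]
    fun x : ℝ => x / Real.log x ^ A
  obtain ⟨A', C, hC'⟩ := hC θ hθ A hA
  have hA2 : 0 < A + max A' 0 := by positivity
  obtain ⟨C₂, hW'⟩ := hW θ hθ (A + max A' 0) hA2 ε hε
  refine Asymptotics.IsBigO.of_bound (|C| * (1 + |C₂|)) ?_
  filter_upwards [hC' ε hε, hW', eventually_ge_atTop (3 : ℝ)] with x hx1 hx2 hx3
  have hx0 : 0 < x := by linarith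
  have hL1 : 1 < Real.log x := by
    rw [Real.lt_log_iff_exp_lt hx0]
    exact lt_of_lt_of_le (by have := Real.exp_one_lt_d9; norm_num at this ⊢; linarith) hx3
  have hL0 : 0 < Real.log x := by linarith
  have hLA : 0 < Real.log x ^ A := Real.rpow_pos_of_pos hL0 A
  -- the sup over coherent residues is bounded by the weak statement
  set S : ℝ := ⨆ b : {b : ℤ // 1 ≤ |b| ∧ (|b| : ℝ) ≤ x},
      ∑ q ∈ Icc 1 ⌊x ^ (θ - ε)⌋₊, fixedResidueError x q (b : ℤ) with hS
  have hne : Nonempty {b : ℤ // 1 ≤ |b| ∧ (|b| : ℝ) ≤ x} :=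
    ⟨⟨1, by simp, by simp; linarith⟩⟩
  have hSle : S ≤ C₂ * x / Real.log x ^ (A + max A' 0) := by
    rw [hS]
    refine ciSup_le fun b => ?_
    exact hx2 b b.2.1 b.2.2
  have hS0 : 0 ≤ S := by
    rw [hS]
    exact Real.iSup_nonneg fun b => Finset.sum_nonneg fun q _ => fixedResidueError_nonneg _ _ _
  -- compare the two powers of log
  have hpow : Real.log x ^ A' * (C₂ * x / Real.log x ^ (A + max A' 0)) ≤ |C₂| * x / Real.log x ^ A := by
    have h1 : Real.log x ^ A' ≤ Real.log x ^ (max A' 0) :=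
      Real.rpow_le_rpow_of_exponent_le hL1.le (le_max_left _ _)
    have h2 : Real.log x ^ (A + max A' 0) = Real.log x ^ A * Real.log x ^ (max A' 0) :=
      Real.rpow_add hL0 _ _
    have hM : 0 < Real.log x ^ (max A' 0) := Real.rpow_pos_of_pos hL0 _
    rw [h2]
    calc Real.log x ^ A' * (C₂ * x / (Real.log x ^ A * Real.log x ^ max A' 0))
        = (C₂ * x / Real.log x ^ A) * (Real.log x ^ A' / Real.log x ^ max A' 0) := by
          field_simp
      _ ≤ (|C₂| * x / Real.log x ^ A) * 1 := by
          apply mul_le_mul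
          · apply div_le_div_of_nonneg_right _ hLA.le
            exact mul_le_mul_of_nonneg_right (le_abs_self _) hx0.le
          · exact (div_le_one hM).mpr h1
          · exact div_nonneg (Real.rpow_nonneg hL0.le _) hM.le
          · exact div_nonneg (mul_nonneg (abs_nonneg _) hx0.le) hLA.le
      _ = |C₂| * x / Real.log x ^ A := by ring
  have hsum0 : 0 ≤ ∑ q ∈ Icc 1 ⌊x ^ (θ - ε)⌋₊, primeAPError x q :=
    Finset.sum_nonneg fun q _ => Literature.NumberTheory.Sieve.primeAPError_nonneg x q
  have hP0 : 0 ≤ x / Real.log x ^ A + Real.log x ^ A' * S :=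
    add_nonneg (div_nonneg hx0.le hLA.le) (mul_nonneg (Real.rpow_nonneg hL0.le _) hS0)
  rw [Real.norm_of_nonneg hsum0, Real.norm_of_nonneg (div_nonneg hx0.le hLA.le)]
  calc ∑ q ∈ Icc 1 ⌊x ^ (θ - ε)⌋₊, primeAPError x q
      ≤ C * (x / Real.log x ^ A + Real.log x ^ A' * S) := hx1
    _ ≤ |C| * (x / Real.log x ^ A + Real.log x ^ A' * S) :=
        mul_le_mul_of_nonneg_right (le_abs_self C) hP0
    _ ≤ |C| * (x / Real.log x ^ A + |C₂| * x / Real.log x ^ A) := by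
        apply mul_le_mul_of_nonneg_left _ (abs_nonneg C)
        have hstep : Real.log x ^ A' * S ≤ |C₂| * x / Real.log x ^ A :=
          (mul_le_mul_of_nonneg_left hSle (Real.rpow_nonneg hL0.le _)).trans hpow
        linarith
    _ = |C| * (1 + |C₂|) * (x / Real.log x ^ A) := by ring

/-- Sanity (the decomposition is not circular): the weak statement is a COROLLARY of the crux
(take the single class `b mod q` inside the max; PROVED, sorry-free). -/
theorem fixedResidueError_le_primeAPError {x : ℝ} {q : ℕ} (hq : q ≠ 0) (hx : 1 ≤ x) (b : ℤ) :
    fixedResidueError x q b ≤ primeAPError x q := by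
  unfold fixedResidueError
  split_ifs with hu
  · obtain ⟨u, hu'⟩ := hu
    haveI : NeZero q := ⟨hq⟩
    have hne : Nonempty (Set.Icc (1 : ℝ) x) := ⟨⟨1, le_rfl, hx⟩⟩
    unfold primeAPError
    refine ciSup_mono (Literature.NumberTheory.Sieve.bddAbove_range_primeAPError x q hq) fun y => ?_
    rw [← hu']
    have hbdd : BddAbove (Set.range fun a : (ZMod q)ˣ =>
        |chebyshevPsiMod q (a : ZMod q) y - (y : ℝ) / Nat.totient q|) :=
      (Set.finite_range _).bddAbove
    exact le_ciSup hbdd u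
  · exact Literature.NumberTheory.Sieve.primeAPError_nonneg x q

theorem weakEHUniform_of_eh (h : EH) : WeakEHUniform := by
  intro θ hθ A hA ε hε
  have h' := h θ hθ A hA ε hε
  change (fun x : ℝ => ∑ q ∈ Icc 1 ⌊x ^ (θ - ε)⌋₊, primeAPError x q) =O[atTop]
    (fun x : ℝ => x / Real.log x ^ A) at h'
  obtain ⟨C, hC⟩ := h'.bound
  refine ⟨C, ?_⟩
  filter_upwards [hC, eventually_ge_atTop (3 : ℝ)] with x hx hx3 b hb1 hbx
  have hx0 : 0 < x := by linarith
  have hL0 : 0 < Real.log x := Real.log_pos (by linarith)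
  have hLA : 0 < Real.log x ^ A := Real.rpow_pos_of_pos hL0 A
  have hsum0 : 0 ≤ ∑ q ∈ Icc 1 ⌊x ^ (θ - ε)⌋₊, primeAPError x q :=
    Finset.sum_nonneg fun q _ => Literature.NumberTheory.Sieve.primeAPError_nonneg x q
  rw [Real.norm_of_nonneg hsum0, Real.norm_of_nonneg (div_nonneg hx0.le hLA.le)] at hx
  calc ∑ q ∈ Icc 1 ⌊x ^ (θ - ε)⌋₊, fixedResidueError x q b
      ≤ ∑ q ∈ Icc 1 ⌊x ^ (θ - ε)⌋₊, primeAPError x q :=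
        Finset.sum_le_sum fun q hq =>
          fixedResidueError_le_primeAPError (by rw [Finset.mem_Icc] at hq; omega) (by linarith) b
    _ ≤ C * (x / Real.log x ^ A) := hx
    _ = C * x / Real.log x ^ A := by ring

/-! ### §3  Route-level finding (tenure): what `closes` really needs from EH -/

/-- `MidParity`: Möbius does not correlate with primes along DILATED shifted progressions
`d ↦ d m + h` for MID-size dilations — for every shift `h ≥ 1` and every `0 < ε < 1/4`,
`∑_{N^{1/2-ε} < d ≤ N^{1-ε}} μ(d) ∑_{N^ε < m ≤ N/d} (log m) Λ(d m + h) = o(N)`.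
This is EXACTLY the part of `PairsFromMAvg`'s identity `∑_{n≤N} Λ(n)Λ(n+h) = ∑_{dm≤N} μ(d) log m
Λ(dm+h)` that the route currently buys from EH at level `1 − ε/2` (the range `d ≤ N^{1/2-ε}` is
Bombieri–Vinogradov, tree `bombieri_vinogradov_holds`; the range `m ≤ N^ε` is `MAvg`). Signed form
(implied by EH); the ℓ¹-over-m form would be the natural engine target. -/
def MidParity : Prop :=
  ∀ h : ℕ, 1 ≤ h → ∀ ε : ℝ, 0 < ε → ε < 1 / 4 →
    (fun N : ℕ =>
        ∑ d ∈ Ioc ⌊(N : ℝ) ^ (1 / 2 - ε)⌋₊ ⌊(N : ℝ) ^ (1 - ε)⌋₊,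
          (ArithmeticFunction.moebius d : ℝ) *
            ∑ m ∈ Ioc ⌊(N : ℝ) ^ ε⌋₊ (N / d),
              Real.log m * ArithmeticFunction.vonMangoldt (d * m + h)) =o[atTop]
      fun N : ℕ => (N : ℝ)

/-- EH (the crux) together with Bombieri–Vinogradov (a theorem in the tree) and PNT-strength
main-term bookkeeping gives `MidParity` (provable, L): under EH at level `1 − ε/2` the d-sum over
`(N^{1/2-ε}, N^{1-ε}]` of `μ(d)·(ψ_log(N; d, h) − main_d)` is `O(N (log N)^{1-A})`, and
`∑_d μ(d) main_d = N·∑_{d in range,(d,h)=1} μ(d)(log(N/d) − 1)/φ(d) + O(N^{1-ε/2}) = o(N)` (tails of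
the convergent series `∑ μ(d)/φ(d)`, `∑ μ(d) log d/φ(d)` over `(d,h)=1`). -/
theorem midParity_of_eh (h : EH) : MidParity := by
  sorry

/-- The EH-free re-assembly (provable, L — same bookkeeping as the route's `PairsFromMAvg`, with
Bombieri–Vinogradov `Literature.NumberTheory.Sieve.bombieri_vinogradov_holds` on `d ≤ N^{1/2-ε}`,
`MidParity` on the mid range and `MAvg` on `m ≤ N^ε`): `MidParity → MAvg → PairsHL`. Replacing the
hypothesis `EH` of `closes` by `MidParity` (a consequence of EH, `midParity_of_eh`) makes the route
unconditional in form: `closes' hD hI hB hS hMP hG := hG (pairsHL_of_midParity hMP (hS hD hI hB))`. -/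
theorem pairsHL_of_midParity (hMP : MidParity) (hM : MAvg) : PairsHL := by
  sorry

/-- The rewired deciding theorem the tenure planner could certify (all names are route decls except
`MidParity`, which would be filed as a new crux item of the route). -/
example (hD : Theses.LiouvilleShiftedTables.DilatedTableChowla)
    (hI : Theses.LiouvilleShiftedTables.TypeI2Dilated) (hB : BVLiouville)
    (hS : Theses.LiouvilleShiftedTables.SieveToMAvg) (hMP : MidParity)
    (hG : Theses.LiouvilleShiftedTables.PairsToGHL) : _root_.GeneralizedHardyLittlewood :=
  hG (pairsHL_of_midParity hMP (hS hD hI hB))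

end Summit.Parity.GeneralizedHardyLittlewood.Cruxes.EH.SketchIdeator1
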